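import Literature.MathematicalPhysics.QuantumFieldTheory.Balaban1983to89.Node00.WilsonActionSecondVariation

/-!
# NODE 00 — THE SECOND VARIATION OF THE WILSON ACTION (5) AT A BACKGROUND, II: the (3.2) INSERTED shape, the CUBIC REMAINDER of (3.7)'s «+ ⋯»,
# and the form at flat plaquette variables («the quadratic form with the background field identically equal to 1», [B16] p.357)

Cell `pub-ymgap`, WIDTH SEAT `pub-ymgap-dag-n12-w2` generation 0 (HUMAN RULING D-0149 ∕ director-ym №197; DAG node N12 = [B15]; W-SEAT-START-LIST v2 §N12 ITEM 2 =
U2a; INBOX INTENT-2 l.24279).  SEQUEL of `Node00.WilsonActionSecondVariation` (this seat, p583639 ✓: the ray `U·e^{tX}` in `Node00.expChart`, the factorisation (3.1)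
`(U·e^{tX})(∂p) = e^{tX′₁}e^{tX′₂}e^{tX′₃}e^{tX′₄}·U(∂p)` with the transported letters `X′₁ = 𝕌₁𝕏₁𝕌₁⋆`, `X′₂ = (𝕌₁𝕌₂)𝕏₂(𝕌₁𝕌₂)⋆`, `X′₃ = −(𝕌₁𝕌₂)𝕏₃(𝕌₁𝕌₂)⋆`,
`X′₄ = −(𝕌₁𝕌₂𝕌₃⋆)𝕏₄(𝕌₁𝕌₂𝕌₃⋆)⋆`, and ★★★ `hasDerivAt_deriv_wilsonAction4_expChart`: `d²∕dt² A(U·e^{tX})∣₀ = −(1∕N)Σ_p Re Tr([(ΣX′)² + Σ_{k<l}[X′_k,X′_l]]·U(∂p))`) —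
CONSUMED BY NAME together with pub-balaban's `Beta.TransportVertices` (`sqSum_add_two_smul_pairSum`, `norm_holonomy_sub_taylor_two_le'`, `size_map_smul`, `sum_map_smul`,
`quad_map_smul`, `two_smul_quad`), `MatrixNorms.abs_nReTr_le_opNorm` (B7 (20)) and Mathlib's `CStarRing.norm_mul_mem_unitary`.
`--kind proof --supports stmt-QuantumFields-20542` (K1⁷; count-neutral).

PRINT.  [B9] = [Balaban1985BackgroundPropagators] p. 390 (3.2): «(∂₀U′)((p)_z) = 1 + iη Σ_b A′(b) − ½η²[Σ_b (A′(b))² + 2 Σ_{b₁≺b₂} A′(b₁)A′(b₂)] + ⋯»; p. 391 (3.6)–(3.7):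
«A^η(U′U₀) = A^η(U₀) + ⟨D^η_{U₀}A, η⁻²Im ∂U₀⟩ + ½⟨A, Δ^η(U₀)A⟩ + ⋯»; p. 392: «generalizing the operator ∂*∂ in the Abelian case».  [B16] = [Balaban1989LargeFieldII] p. 357:
«the function V is at least of third order in the argument»; «The leading term in the expansion is the quadratic form with the background field identically equal to 1»; (1.7) p. 358.

CONTENTS (theorems only; no `def`, no `instance`; letters as in the prequel's module docstring, `𝕌₁ = U⟨x,μ⟩, 𝕌₂ = U⟨x+e_μ,ν⟩, 𝕌₃ = U⟨x+e_ν,μ⟩, 𝕌₄ = U⟨x,ν⟩`).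
* §1 four unitaries ∕ four letters: ★ `sum_letters_mul_eq_fourTerm` — `(ΣX′)·(ABC⋆D⋆)` = n07-e g8's four-term Leibniz sum (`hasDerivAt_coe_plaqHol`) at the velocities `𝕌_b𝕏_b`
  (the transports telescope); ★ `sq_add_commSum_mul_eq_inserted` — `[(ΣX′)² + Σ_{k<l}[X′_k,X′_l]]·(ABC⋆D⋆)` = four squares + twice six ordered pairs INSERTED (the (3.2) bracket
  read in the frames of the bonds).
* §2 on the lattice: ★ `hasDerivAt_deriv_wilsonAction4_expChart_inserted` (the second variation in the (3.2) shape); `size_letters_eq` (`Σ_k‖X′_k‖ = Σ_k‖X_{b_k}‖`, operator norm).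
* §3 ★ `abs_re_trace_holPath_sub_taylor_two_le` (per contour) and ★★ `abs_wilsonAction4_expChart_sub_taylor_two_le` — (3.7) with the dots QUANTIFIED:
  `|A(U·e^{tX}) − A(U) − t·L − (t²∕2)·Q| ≤ Σ_p (|t|s_p)³e^{|t|s_p}∕6`, `L`∕`Q` the first∕second variation of the prequel, `s_p = Σ_k‖X′_k‖`.
* §4 skew-Hermitian bookkeeping (`star_conj_of_star_eq_neg`, `star_sum_of_skew`, `star_commSum_of_skew`, `re_trace_eq_zero_of_star_eq_neg`, `re_trace_mul_self_of_star_eq_neg`,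
  `star_letters_eq_neg`) and ★★ `secondVariation_expChart_of_plaqHol_eq_one` — at `U(∂p) = 1` for all `p` the commutator term is traceless and
  `d²∕dt² A(U·e^{tX})∣₀ = (1∕N)·Σ_p Re Tr(σ_p⋆σ_p)`, `σ_p = ΣX′` (the `∂*∂`-type leading form U2c compares with [10] (1.65)–(1.67)).

HONEST FRAMING: calculus ∕ algebra identities and one elementary remainder estimate about the tree's own action functional; nothing of Bałaban's ESTIMATES is asserted;
dischargeability-neutral for N12's (L2) letter `hlead` until U2b (linearised minimiser) and U2c (comparison with [10]) exist; count-neutral; N12 NOT discharged (5∕27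
unmoved); one finite 𝕋⁴ programme at fixed ε, Bałaban AS PRINTED with locators; R4 closes the conditional rung `BalabanLadder.UV` only — NOT continuum ∕ ℝ⁴ ∕ OS ∕ mass
gap ∕ Clay.  No `sorry`, no `def`, no `instance`.
-/

noncomputable section

namespace Literature.MathematicalPhysics.QuantumFieldTheory.Balaban1983to89.Node00

open T4AdjointCovarianceUnitary (lieSU mem_lieSU_iff)
open Beta.TransportVertices (holPath holonomy D₁ D₂ quad commSum size sqSum pairSum sqSum_cons sqSum_nil pairSum_cons pairSum_nil sqSum_add_two_smul_pairSum holPath_zero size_map_smul sum_map_smul quad_map_smul two_smul_quad norm_holonomy_sub_taylor_two_le')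
open scoped Matrix.Norms.L2Operator

/-! ## §1  The (3.2) shapes: the letters INSERTED into `𝕌₁𝕌₂𝕌₃⋆𝕌₄⋆` (four squares + twice six ordered pairs; the first variation = g8's four-term sum) -/

section Inserted
variable {N : ℕ}

/-- ★ **THE FIRST-ORDER LETTER SUM INSERTED**: `(X′₁+X′₂+X′₃+X′₄)·(ABC⋆D⋆) = (AX₁)BC⋆D⋆ + A(BX₂)C⋆D⋆ + AB(CX₃)⋆D⋆ + ABC⋆(DX₄)⋆` — g8's four-term Leibniz sum
(`hasDerivAt_coe_plaqHol`) at the bond-wise velocities `𝕌_b𝕏_b` of the ray: the transports telescope. [cite: Balaban1985BackgroundPropagators, (3.2) p.390; Balaban1985Variational, (5) p.278] -/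
theorem sum_letters_mul_eq_fourTerm (A B C D : SU N) (X₁ X₂ X₃ X₄ : lieSU (Fin N)) :
    ((A : Matrix (Fin N) (Fin N) ℂ) * (X₁ : Matrix (Fin N) (Fin N) ℂ) * star (A : Matrix (Fin N) (Fin N) ℂ)
        + (A : Matrix (Fin N) (Fin N) ℂ) * (B : Matrix (Fin N) (Fin N) ℂ) * (X₂ : Matrix (Fin N) (Fin N) ℂ) * star ((A : Matrix (Fin N) (Fin N) ℂ) * (B : Matrix (Fin N) (Fin N) ℂ))
        + -((A : Matrix (Fin N) (Fin N) ℂ) * (B : Matrix (Fin N) (Fin N) ℂ) * (X₃ : Matrix (Fin N) (Fin N) ℂ) * star ((A : Matrix (Fin N) (Fin N) ℂ) * (B : Matrix (Fin N) (Fin N) ℂ)))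
        + -((A : Matrix (Fin N) (Fin N) ℂ) * (B : Matrix (Fin N) (Fin N) ℂ) * star (C : Matrix (Fin N) (Fin N) ℂ) * (X₄ : Matrix (Fin N) (Fin N) ℂ)
            * star ((A : Matrix (Fin N) (Fin N) ℂ) * (B : Matrix (Fin N) (Fin N) ℂ) * star (C : Matrix (Fin N) (Fin N) ℂ))))
      * ((A : Matrix (Fin N) (Fin N) ℂ) * (B : Matrix (Fin N) (Fin N) ℂ) * star (C : Matrix (Fin N) (Fin N) ℂ) * star (D : Matrix (Fin N) (Fin N) ℂ))
    = (A : Matrix (Fin N) (Fin N) ℂ) * (X₁ : Matrix (Fin N) (Fin N) ℂ) * (B : Matrix (Fin N) (Fin N) ℂ) * star (C : Matrix (Fin N) (Fin N) ℂ) * star (D : Matrix (Fin N) (Fin N) ℂ)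
      + (A : Matrix (Fin N) (Fin N) ℂ) * ((B : Matrix (Fin N) (Fin N) ℂ) * (X₂ : Matrix (Fin N) (Fin N) ℂ)) * star (C : Matrix (Fin N) (Fin N) ℂ) * star (D : Matrix (Fin N) (Fin N) ℂ)
      + (A : Matrix (Fin N) (Fin N) ℂ) * (B : Matrix (Fin N) (Fin N) ℂ) * star ((C : Matrix (Fin N) (Fin N) ℂ) * (X₃ : Matrix (Fin N) (Fin N) ℂ)) * star (D : Matrix (Fin N) (Fin N) ℂ)
      + (A : Matrix (Fin N) (Fin N) ℂ) * (B : Matrix (Fin N) (Fin N) ℂ) * star (C : Matrix (Fin N) (Fin N) ℂ) * star ((D : Matrix (Fin N) (Fin N) ℂ) * (X₄ : Matrix (Fin N) (Fin N) ℂ)) := by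
  simp only [add_mul, neg_mul, star_mul, star_star, star_coe_lieSU, mul_neg, mul_assoc, star_coe_mul_coe_mul_SU, coe_mul_star_coe_mul_SU]

/-- ★ **THE SECOND-ORDER LETTERS INSERTED** — the bracket of (3.2) «Σ_b (A′(b))² + 2Σ_{b₁≺b₂} A′(b₁)A′(b₂)» against the plaquette variable, read in the frames of the
four bonds: `[(ΣX′)² + Σ_{k<l}[X′_k,X′_l]]·(ABC⋆D⋆) = AX₁²BC⋆D⋆ + ABX₂²C⋆D⋆ + ABX₃²C⋆D⋆ + ABC⋆X₄²D⋆ + 2·(AX₁BX₂C⋆D⋆ − AX₁BX₃C⋆D⋆ − AX₁BC⋆X₄D⋆ − ABX₂X₃C⋆D⋆ − ABX₂C⋆X₄D⋆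
+ ABX₃C⋆X₄D⋆)` (pub-balaban's `sqSum_add_two_smul_pairSum`: `Σa_k² + 2Σ_{k<l}a_ka_l = (Σa_k)² + Σ_{k<l}[a_k,a_l]`; the transports telescope for `k < l`).
[cite: Balaban1985BackgroundPropagators, (3.2) p.390, (3.6) p.391] -/
theorem sq_add_commSum_mul_eq_inserted (A B C D : SU N) (X₁ X₂ X₃ X₄ : lieSU (Fin N)) :
    (((A : Matrix (Fin N) (Fin N) ℂ) * (X₁ : Matrix (Fin N) (Fin N) ℂ) * star (A : Matrix (Fin N) (Fin N) ℂ)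
        + (A : Matrix (Fin N) (Fin N) ℂ) * (B : Matrix (Fin N) (Fin N) ℂ) * (X₂ : Matrix (Fin N) (Fin N) ℂ) * star ((A : Matrix (Fin N) (Fin N) ℂ) * (B : Matrix (Fin N) (Fin N) ℂ))
        + -((A : Matrix (Fin N) (Fin N) ℂ) * (B : Matrix (Fin N) (Fin N) ℂ) * (X₃ : Matrix (Fin N) (Fin N) ℂ) * star ((A : Matrix (Fin N) (Fin N) ℂ) * (B : Matrix (Fin N) (Fin N) ℂ)))
        + -((A : Matrix (Fin N) (Fin N) ℂ) * (B : Matrix (Fin N) (Fin N) ℂ) * star (C : Matrix (Fin N) (Fin N) ℂ) * (X₄ : Matrix (Fin N) (Fin N) ℂ)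
            * star ((A : Matrix (Fin N) (Fin N) ℂ) * (B : Matrix (Fin N) (Fin N) ℂ) * star (C : Matrix (Fin N) (Fin N) ℂ))))
        * ((A : Matrix (Fin N) (Fin N) ℂ) * (X₁ : Matrix (Fin N) (Fin N) ℂ) * star (A : Matrix (Fin N) (Fin N) ℂ)
        + (A : Matrix (Fin N) (Fin N) ℂ) * (B : Matrix (Fin N) (Fin N) ℂ) * (X₂ : Matrix (Fin N) (Fin N) ℂ) * star ((A : Matrix (Fin N) (Fin N) ℂ) * (B : Matrix (Fin N) (Fin N) ℂ))
        + -((A : Matrix (Fin N) (Fin N) ℂ) * (B : Matrix (Fin N) (Fin N) ℂ) * (X₃ : Matrix (Fin N) (Fin N) ℂ) * star ((A : Matrix (Fin N) (Fin N) ℂ) * (B : Matrix (Fin N) (Fin N) ℂ)))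
        + -((A : Matrix (Fin N) (Fin N) ℂ) * (B : Matrix (Fin N) (Fin N) ℂ) * star (C : Matrix (Fin N) (Fin N) ℂ) * (X₄ : Matrix (Fin N) (Fin N) ℂ)
            * star ((A : Matrix (Fin N) (Fin N) ℂ) * (B : Matrix (Fin N) (Fin N) ℂ) * star (C : Matrix (Fin N) (Fin N) ℂ))))
      + commSum [ (A : Matrix (Fin N) (Fin N) ℂ) * (X₁ : Matrix (Fin N) (Fin N) ℂ) * star (A : Matrix (Fin N) (Fin N) ℂ),
          (A : Matrix (Fin N) (Fin N) ℂ) * (B : Matrix (Fin N) (Fin N) ℂ) * (X₂ : Matrix (Fin N) (Fin N) ℂ) * star ((A : Matrix (Fin N) (Fin N) ℂ) * (B : Matrix (Fin N) (Fin N) ℂ)),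
          -((A : Matrix (Fin N) (Fin N) ℂ) * (B : Matrix (Fin N) (Fin N) ℂ) * (X₃ : Matrix (Fin N) (Fin N) ℂ) * star ((A : Matrix (Fin N) (Fin N) ℂ) * (B : Matrix (Fin N) (Fin N) ℂ))),
          -((A : Matrix (Fin N) (Fin N) ℂ) * (B : Matrix (Fin N) (Fin N) ℂ) * star (C : Matrix (Fin N) (Fin N) ℂ) * (X₄ : Matrix (Fin N) (Fin N) ℂ)
            * star ((A : Matrix (Fin N) (Fin N) ℂ) * (B : Matrix (Fin N) (Fin N) ℂ) * star (C : Matrix (Fin N) (Fin N) ℂ))) ])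
      * ((A : Matrix (Fin N) (Fin N) ℂ) * (B : Matrix (Fin N) (Fin N) ℂ) * star (C : Matrix (Fin N) (Fin N) ℂ) * star (D : Matrix (Fin N) (Fin N) ℂ))
    = (A : Matrix (Fin N) (Fin N) ℂ) * ((X₁ : Matrix (Fin N) (Fin N) ℂ) * (X₁ : Matrix (Fin N) (Fin N) ℂ)) * (B : Matrix (Fin N) (Fin N) ℂ) * star (C : Matrix (Fin N) (Fin N) ℂ) * star (D : Matrix (Fin N) (Fin N) ℂ)
      + (A : Matrix (Fin N) (Fin N) ℂ) * (B : Matrix (Fin N) (Fin N) ℂ) * ((X₂ : Matrix (Fin N) (Fin N) ℂ) * (X₂ : Matrix (Fin N) (Fin N) ℂ)) * star (C : Matrix (Fin N) (Fin N) ℂ) * star (D : Matrix (Fin N) (Fin N) ℂ)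
      + (A : Matrix (Fin N) (Fin N) ℂ) * (B : Matrix (Fin N) (Fin N) ℂ) * ((X₃ : Matrix (Fin N) (Fin N) ℂ) * (X₃ : Matrix (Fin N) (Fin N) ℂ)) * star (C : Matrix (Fin N) (Fin N) ℂ) * star (D : Matrix (Fin N) (Fin N) ℂ)
      + (A : Matrix (Fin N) (Fin N) ℂ) * (B : Matrix (Fin N) (Fin N) ℂ) * star (C : Matrix (Fin N) (Fin N) ℂ) * ((X₄ : Matrix (Fin N) (Fin N) ℂ) * (X₄ : Matrix (Fin N) (Fin N) ℂ)) * star (D : Matrix (Fin N) (Fin N) ℂ)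
      + 2 • ((A : Matrix (Fin N) (Fin N) ℂ) * (X₁ : Matrix (Fin N) (Fin N) ℂ) * (B : Matrix (Fin N) (Fin N) ℂ) * (X₂ : Matrix (Fin N) (Fin N) ℂ) * star (C : Matrix (Fin N) (Fin N) ℂ) * star (D : Matrix (Fin N) (Fin N) ℂ)
          - (A : Matrix (Fin N) (Fin N) ℂ) * (X₁ : Matrix (Fin N) (Fin N) ℂ) * (B : Matrix (Fin N) (Fin N) ℂ) * (X₃ : Matrix (Fin N) (Fin N) ℂ) * star (C : Matrix (Fin N) (Fin N) ℂ) * star (D : Matrix (Fin N) (Fin N) ℂ)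
          - (A : Matrix (Fin N) (Fin N) ℂ) * (X₁ : Matrix (Fin N) (Fin N) ℂ) * (B : Matrix (Fin N) (Fin N) ℂ) * star (C : Matrix (Fin N) (Fin N) ℂ) * (X₄ : Matrix (Fin N) (Fin N) ℂ) * star (D : Matrix (Fin N) (Fin N) ℂ)
          - (A : Matrix (Fin N) (Fin N) ℂ) * (B : Matrix (Fin N) (Fin N) ℂ) * (X₂ : Matrix (Fin N) (Fin N) ℂ) * (X₃ : Matrix (Fin N) (Fin N) ℂ) * star (C : Matrix (Fin N) (Fin N) ℂ) * star (D : Matrix (Fin N) (Fin N) ℂ)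
          - (A : Matrix (Fin N) (Fin N) ℂ) * (B : Matrix (Fin N) (Fin N) ℂ) * (X₂ : Matrix (Fin N) (Fin N) ℂ) * star (C : Matrix (Fin N) (Fin N) ℂ) * (X₄ : Matrix (Fin N) (Fin N) ℂ) * star (D : Matrix (Fin N) (Fin N) ℂ)
          + (A : Matrix (Fin N) (Fin N) ℂ) * (B : Matrix (Fin N) (Fin N) ℂ) * (X₃ : Matrix (Fin N) (Fin N) ℂ) * star (C : Matrix (Fin N) (Fin N) ℂ) * (X₄ : Matrix (Fin N) (Fin N) ℂ) * star (D : Matrix (Fin N) (Fin N) ℂ)) := by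
  set a := (A : Matrix (Fin N) (Fin N) ℂ) * (X₁ : Matrix (Fin N) (Fin N) ℂ) * star (A : Matrix (Fin N) (Fin N) ℂ) with ha
  set b := (A : Matrix (Fin N) (Fin N) ℂ) * (B : Matrix (Fin N) (Fin N) ℂ) * (X₂ : Matrix (Fin N) (Fin N) ℂ)
    * star ((A : Matrix (Fin N) (Fin N) ℂ) * (B : Matrix (Fin N) (Fin N) ℂ)) with hb
  set c := -((A : Matrix (Fin N) (Fin N) ℂ) * (B : Matrix (Fin N) (Fin N) ℂ) * (X₃ : Matrix (Fin N) (Fin N) ℂ)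
    * star ((A : Matrix (Fin N) (Fin N) ℂ) * (B : Matrix (Fin N) (Fin N) ℂ))) with hc
  set d := -((A : Matrix (Fin N) (Fin N) ℂ) * (B : Matrix (Fin N) (Fin N) ℂ) * star (C : Matrix (Fin N) (Fin N) ℂ) * (X₄ : Matrix (Fin N) (Fin N) ℂ)
    * star ((A : Matrix (Fin N) (Fin N) ℂ) * (B : Matrix (Fin N) (Fin N) ℂ) * star (C : Matrix (Fin N) (Fin N) ℂ))) with hd
  have hs : a + b + c + d = [a, b, c, d].sum := by simp only [List.sum_cons, List.sum_nil, add_zero, add_assoc]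
  rw [hs, ← sqSum_add_two_smul_pairSum]
  simp only [sqSum_cons, sqSum_nil, pairSum_cons, pairSum_nil, List.sum_cons, List.sum_nil, add_zero, zero_add, mul_zero, ha, hb, hc, hd]
  simp only [add_mul, mul_add, smul_add, smul_mul_assoc, neg_mul, mul_neg, neg_neg, star_mul, star_star, mul_assoc,
    star_coe_mul_coe_mul_SU, coe_mul_star_coe_mul_SU, smul_sub]
  abel

end Inserted

/-! ## §2  On the lattice: the second variation in the INSERTED (3.2) shape, and the size of the letters -/

section LatticeInserted
variable {P : Params} {j : ℕ} {N : ℕ} [NeZero N]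

/-- ★ **THE SECOND VARIATION, (3.2) SHAPE**: `d²∕dt² A(U·e^{tX})∣₀ = −(1∕N)·Σ_p Re Tr( 𝕌₁𝕏₁²𝕌₂𝕌₃⋆𝕌₄⋆ + 𝕌₁𝕌₂𝕏₂²𝕌₃⋆𝕌₄⋆ + 𝕌₁𝕌₂𝕏₃²𝕌₃⋆𝕌₄⋆ + 𝕌₁𝕌₂𝕌₃⋆𝕏₄²𝕌₄⋆
+ 2·[𝕌₁𝕏₁𝕌₂𝕏₂𝕌₃⋆𝕌₄⋆ − 𝕌₁𝕏₁𝕌₂𝕏₃𝕌₃⋆𝕌₄⋆ − 𝕌₁𝕏₁𝕌₂𝕌₃⋆𝕏₄𝕌₄⋆ − 𝕌₁𝕌₂𝕏₂𝕏₃𝕌₃⋆𝕌₄⋆ − 𝕌₁𝕌₂𝕏₂𝕌₃⋆𝕏₄𝕌₄⋆ + 𝕌₁𝕌₂𝕏₃𝕌₃⋆𝕏₄𝕌₄⋆] )` — «−½η²[Σ_b(A′(b))² + 2Σ_{b₁≺b₂}A′(b₁)A′(b₂)]»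
read in the frames of the bonds (the Leibniz∕product-rule form: every second-order placement of the 𝔰𝔲(N) letters in `𝕌₁e^{tX₁}𝕌₂e^{tX₂}e^{−tX₃}𝕌₃⋆e^{−tX₄}𝕌₄⋆`).
[cite: Balaban1985BackgroundPropagators, (3.1)–(3.2) p.390, (3.6) p.391] -/
theorem hasDerivAt_deriv_wilsonAction4_expChart_inserted (U : GaugeField P j (SU N)) (X : PBond P j → lieSU (Fin N)) :
    HasDerivAt (deriv fun s : ℝ => wilsonAction4 (expChart U (s • X)))
      (-(∑ p : Plaq P j, (Matrix.trace
        ((U ⟨p.src, p.μ⟩ : Matrix (Fin N) (Fin N) ℂ) * ((X ⟨p.src, p.μ⟩ : Matrix (Fin N) (Fin N) ℂ) * (X ⟨p.src, p.μ⟩ : Matrix (Fin N) (Fin N) ℂ))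
            * (U ⟨p.src.shift p.μ, p.ν⟩ : Matrix (Fin N) (Fin N) ℂ) * star (U ⟨p.src.shift p.ν, p.μ⟩ : Matrix (Fin N) (Fin N) ℂ) * star (U ⟨p.src, p.ν⟩ : Matrix (Fin N) (Fin N) ℂ)
        + (U ⟨p.src, p.μ⟩ : Matrix (Fin N) (Fin N) ℂ) * (U ⟨p.src.shift p.μ, p.ν⟩ : Matrix (Fin N) (Fin N) ℂ)
            * ((X ⟨p.src.shift p.μ, p.ν⟩ : Matrix (Fin N) (Fin N) ℂ) * (X ⟨p.src.shift p.μ, p.ν⟩ : Matrix (Fin N) (Fin N) ℂ))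
            * star (U ⟨p.src.shift p.ν, p.μ⟩ : Matrix (Fin N) (Fin N) ℂ) * star (U ⟨p.src, p.ν⟩ : Matrix (Fin N) (Fin N) ℂ)
        + (U ⟨p.src, p.μ⟩ : Matrix (Fin N) (Fin N) ℂ) * (U ⟨p.src.shift p.μ, p.ν⟩ : Matrix (Fin N) (Fin N) ℂ)
            * ((X ⟨p.src.shift p.ν, p.μ⟩ : Matrix (Fin N) (Fin N) ℂ) * (X ⟨p.src.shift p.ν, p.μ⟩ : Matrix (Fin N) (Fin N) ℂ))
            * star (U ⟨p.src.shift p.ν, p.μ⟩ : Matrix (Fin N) (Fin N) ℂ) * star (U ⟨p.src, p.ν⟩ : Matrix (Fin N) (Fin N) ℂ)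
        + (U ⟨p.src, p.μ⟩ : Matrix (Fin N) (Fin N) ℂ) * (U ⟨p.src.shift p.μ, p.ν⟩ : Matrix (Fin N) (Fin N) ℂ) * star (U ⟨p.src.shift p.ν, p.μ⟩ : Matrix (Fin N) (Fin N) ℂ)
            * ((X ⟨p.src, p.ν⟩ : Matrix (Fin N) (Fin N) ℂ) * (X ⟨p.src, p.ν⟩ : Matrix (Fin N) (Fin N) ℂ)) * star (U ⟨p.src, p.ν⟩ : Matrix (Fin N) (Fin N) ℂ)
        + 2 • ((U ⟨p.src, p.μ⟩ : Matrix (Fin N) (Fin N) ℂ) * (X ⟨p.src, p.μ⟩ : Matrix (Fin N) (Fin N) ℂ) * (U ⟨p.src.shift p.μ, p.ν⟩ : Matrix (Fin N) (Fin N) ℂ)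
              * (X ⟨p.src.shift p.μ, p.ν⟩ : Matrix (Fin N) (Fin N) ℂ) * star (U ⟨p.src.shift p.ν, p.μ⟩ : Matrix (Fin N) (Fin N) ℂ) * star (U ⟨p.src, p.ν⟩ : Matrix (Fin N) (Fin N) ℂ)
            - (U ⟨p.src, p.μ⟩ : Matrix (Fin N) (Fin N) ℂ) * (X ⟨p.src, p.μ⟩ : Matrix (Fin N) (Fin N) ℂ) * (U ⟨p.src.shift p.μ, p.ν⟩ : Matrix (Fin N) (Fin N) ℂ)
              * (X ⟨p.src.shift p.ν, p.μ⟩ : Matrix (Fin N) (Fin N) ℂ) * star (U ⟨p.src.shift p.ν, p.μ⟩ : Matrix (Fin N) (Fin N) ℂ) * star (U ⟨p.src, p.ν⟩ : Matrix (Fin N) (Fin N) ℂ)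
            - (U ⟨p.src, p.μ⟩ : Matrix (Fin N) (Fin N) ℂ) * (X ⟨p.src, p.μ⟩ : Matrix (Fin N) (Fin N) ℂ) * (U ⟨p.src.shift p.μ, p.ν⟩ : Matrix (Fin N) (Fin N) ℂ)
              * star (U ⟨p.src.shift p.ν, p.μ⟩ : Matrix (Fin N) (Fin N) ℂ) * (X ⟨p.src, p.ν⟩ : Matrix (Fin N) (Fin N) ℂ) * star (U ⟨p.src, p.ν⟩ : Matrix (Fin N) (Fin N) ℂ)
            - (U ⟨p.src, p.μ⟩ : Matrix (Fin N) (Fin N) ℂ) * (U ⟨p.src.shift p.μ, p.ν⟩ : Matrix (Fin N) (Fin N) ℂ) * (X ⟨p.src.shift p.μ, p.ν⟩ : Matrix (Fin N) (Fin N) ℂ)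
              * (X ⟨p.src.shift p.ν, p.μ⟩ : Matrix (Fin N) (Fin N) ℂ) * star (U ⟨p.src.shift p.ν, p.μ⟩ : Matrix (Fin N) (Fin N) ℂ) * star (U ⟨p.src, p.ν⟩ : Matrix (Fin N) (Fin N) ℂ)
            - (U ⟨p.src, p.μ⟩ : Matrix (Fin N) (Fin N) ℂ) * (U ⟨p.src.shift p.μ, p.ν⟩ : Matrix (Fin N) (Fin N) ℂ) * (X ⟨p.src.shift p.μ, p.ν⟩ : Matrix (Fin N) (Fin N) ℂ)
              * star (U ⟨p.src.shift p.ν, p.μ⟩ : Matrix (Fin N) (Fin N) ℂ) * (X ⟨p.src, p.ν⟩ : Matrix (Fin N) (Fin N) ℂ) * star (U ⟨p.src, p.ν⟩ : Matrix (Fin N) (Fin N) ℂ)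
            + (U ⟨p.src, p.μ⟩ : Matrix (Fin N) (Fin N) ℂ) * (U ⟨p.src.shift p.μ, p.ν⟩ : Matrix (Fin N) (Fin N) ℂ) * (X ⟨p.src.shift p.ν, p.μ⟩ : Matrix (Fin N) (Fin N) ℂ)
              * star (U ⟨p.src.shift p.ν, p.μ⟩ : Matrix (Fin N) (Fin N) ℂ) * (X ⟨p.src, p.ν⟩ : Matrix (Fin N) (Fin N) ℂ) * star (U ⟨p.src, p.ν⟩ : Matrix (Fin N) (Fin N) ℂ)))).re)
        / (Fintype.card (Fin N) : ℝ)) 0 := by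
  refine (hasDerivAt_deriv_wilsonAction4_expChart U X).congr_deriv ?_
  congr 1; congr 1
  refine Finset.sum_congr rfl fun p _ => ?_
  rw [coe_plaqHol_eq, sq_add_commSum_mul_eq_inserted]

omit [NeZero N] in
/-- The size of the transported letters is the size of the bare letters: `Σ_k ‖X′_k‖ = ‖X₁‖ + ‖X₂‖ + ‖X₃‖ + ‖X₄‖` in the operator norm (19) (unitary conjugation and the
signs of (3.5) do not change it) — so the cubic remainder of §3 is `(|t|·Σ_k‖X_{b_k}‖)³e^{|t|Σ_k‖X_{b_k}‖}∕6` per plaquette. [cite: Balaban1985Averaging, (19) p.21; Balaban1985BackgroundPropagators, (3.2) p.390] -/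
theorem size_letters_eq (A B C : SU N) (X₁ X₂ X₃ X₄ : lieSU (Fin N)) :
    size [ (A : Matrix (Fin N) (Fin N) ℂ) * (X₁ : Matrix (Fin N) (Fin N) ℂ) * star (A : Matrix (Fin N) (Fin N) ℂ),
        (A : Matrix (Fin N) (Fin N) ℂ) * (B : Matrix (Fin N) (Fin N) ℂ) * (X₂ : Matrix (Fin N) (Fin N) ℂ) * star ((A : Matrix (Fin N) (Fin N) ℂ) * (B : Matrix (Fin N) (Fin N) ℂ)),
        -((A : Matrix (Fin N) (Fin N) ℂ) * (B : Matrix (Fin N) (Fin N) ℂ) * (X₃ : Matrix (Fin N) (Fin N) ℂ) * star ((A : Matrix (Fin N) (Fin N) ℂ) * (B : Matrix (Fin N) (Fin N) ℂ))),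
        -((A : Matrix (Fin N) (Fin N) ℂ) * (B : Matrix (Fin N) (Fin N) ℂ) * star (C : Matrix (Fin N) (Fin N) ℂ) * (X₄ : Matrix (Fin N) (Fin N) ℂ)
            * star ((A : Matrix (Fin N) (Fin N) ℂ) * (B : Matrix (Fin N) (Fin N) ℂ) * star (C : Matrix (Fin N) (Fin N) ℂ))) ]
      = ‖(X₁ : Matrix (Fin N) (Fin N) ℂ)‖ + ‖(X₂ : Matrix (Fin N) (Fin N) ℂ)‖ + ‖(X₃ : Matrix (Fin N) (Fin N) ℂ)‖ + ‖(X₄ : Matrix (Fin N) (Fin N) ℂ)‖ := by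
  have hmem : ∀ g : SU N, (g : Matrix (Fin N) (Fin N) ℂ) ∈ unitary (Matrix (Fin N) (Fin N) ℂ) := fun g => g.2.1
  have h2 : ((A * B : SU N) : Matrix (Fin N) (Fin N) ℂ) = (A : Matrix (Fin N) (Fin N) ℂ) * (B : Matrix (Fin N) (Fin N) ℂ) := rfl
  have h3 : ((A * B * C⁻¹ : SU N) : Matrix (Fin N) (Fin N) ℂ) = (A : Matrix (Fin N) (Fin N) ℂ) * (B : Matrix (Fin N) (Fin N) ℂ) * star (C : Matrix (Fin N) (Fin N) ℂ) := rfl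
  have hconj : ∀ (g : SU N) (Y : Matrix (Fin N) (Fin N) ℂ), ‖(g : Matrix (Fin N) (Fin N) ℂ) * Y * star (g : Matrix (Fin N) (Fin N) ℂ)‖ = ‖Y‖ := fun g Y => by
    rw [CStarRing.norm_mul_mem_unitary _ (Unitary.star_mem (hmem g)), CStarRing.norm_mem_unitary_mul _ (hmem g)]
  rw [← h3, ← h2]
  simp only [Beta.TransportVertices.size_cons, Beta.TransportVertices.size_nil, add_zero, norm_neg, hconj, add_assoc]

end LatticeInserted

/-! ## §3  (3.7)'s «+ ⋯» is THIRD ORDER: the exact second-order expansion along the ray with a cubic remainder -/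

section Taylor
variable {N : ℕ}

/-- **PER CONTOUR**: for letters `l`, a UNITARY plaquette variable `W` and `t ∈ ℝ`,
`|Re Tr(Π_k e^{t a_k}·W)∕N − Re Tr(W)∕N − t·Re Tr((Σa)·W)∕N − (t²∕2)·Re Tr([(Σa)² + Σ_{k<l}[a_k,a_l]]·W)∕N| ≤ (|t|s)³e^{|t|s}∕6`, `s = Σ_k ‖a_k‖` — pub-balaban's
`norm_holonomy_sub_taylor_two_le'` (the remainder `Π e^{ta_k} − 1 − tΣa − t²·quad` is cubic) read through B7 (20) `|Re tr M| ≤ ‖M‖` and `‖M·W‖ = ‖M‖`.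
[cite: Balaban1985BackgroundPropagators, (3.6)–(3.7) p.391; Balaban1985Averaging, (20) p.21] -/
theorem abs_re_trace_holPath_sub_taylor_two_le (l : List (Matrix (Fin N) (Fin N) ℂ)) {W : Matrix (Fin N) (Fin N) ℂ}
    (hW : W ∈ unitary (Matrix (Fin N) (Fin N) ℂ)) (t : ℝ) :
    |(Matrix.trace (holPath ℝ l t * W)).re / (Fintype.card (Fin N) : ℝ) - (Matrix.trace W).re / (Fintype.card (Fin N) : ℝ)
        - t * ((Matrix.trace (l.sum * W)).re / (Fintype.card (Fin N) : ℝ))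
        - t ^ 2 / 2 * ((Matrix.trace ((l.sum * l.sum + commSum l) * W)).re / (Fintype.card (Fin N) : ℝ))|
      ≤ (|t| * size l) ^ 3 / 6 * Real.exp (|t| * size l) := by
  set R := holonomy (l.map (t • ·)) - 1 - (l.map (t • ·)).sum - quad ℝ (l.map (t • ·)) with hR
  have hq : (t ^ 2 / 2) • (l.sum * l.sum + commSum l) = quad ℝ (l.map (t • ·)) := by
    rw [quad_map_smul, ← two_smul_quad ℝ l, smul_smul]
    congr 1
    ring
  have hRW : holPath ℝ l t * W - W - t • (l.sum * W) - (t ^ 2 / 2) • ((l.sum * l.sum + commSum l) * W) = R * W := by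
    rw [hR, ← smul_mul_assoc, ← smul_mul_assoc, hq, ← sum_map_smul ℝ t l, sub_mul, sub_mul, sub_mul, one_mul]
    rfl
  have key : (Matrix.trace (holPath ℝ l t * W)).re / (Fintype.card (Fin N) : ℝ) - (Matrix.trace W).re / (Fintype.card (Fin N) : ℝ)
        - t * ((Matrix.trace (l.sum * W)).re / (Fintype.card (Fin N) : ℝ))
        - t ^ 2 / 2 * ((Matrix.trace ((l.sum * l.sum + commSum l) * W)).re / (Fintype.card (Fin N) : ℝ))
      = (Matrix.trace (R * W)).re / (Fintype.card (Fin N) : ℝ) := by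
    rw [← hRW]
    simp only [Matrix.trace_sub, Matrix.trace_smul, Complex.sub_re, Complex.real_smul, Complex.re_ofReal_mul]
    ring
  rw [key]
  have h1 : |(Matrix.trace (R * W)).re / (Fintype.card (Fin N) : ℝ)| ≤ ‖R * W‖ := MatrixNorms.abs_nReTr_le_opNorm (R * W)
  have h2 : ‖R * W‖ = ‖R‖ := CStarRing.norm_mul_mem_unitary R hW
  have h3 : ‖R‖ ≤ size (l.map (t • ·)) ^ 3 / 6 * Real.exp (size (l.map (t • ·))) := norm_holonomy_sub_taylor_two_le' ℝ _
  rw [size_map_smul, Real.norm_eq_abs] at h3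
  exact h1.trans (h2.le.trans h3)

variable {P : Params} {j : ℕ} [NeZero N]

/-- ★ **THE SECOND-ORDER EXPANSION OF THE WILSON ACTION ALONG THE RAY, WITH CUBIC REMAINDER** — (3.7) «A^η(U′U₀) = A^η(U₀) + ⟨D A, η⁻²Im ∂U₀⟩ +
½⟨A, Δ^η(U₀)A⟩ + ⋯» with the dots QUANTIFIED: `|A(U·e^{tX}) − A(U) − t·L − (t²∕2)·Q| ≤ Σ_p (|t|s_p)³e^{|t|s_p}∕6`, where `L = −(1∕N)Σ_p Re Tr((ΣX′)·U(∂p))` is the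
first variation (`deriv_wilsonAction4_expChart_zero`), `Q = −(1∕N)Σ_p Re Tr([(ΣX′)² + Σ_{k<l}[X′_k,X′_l]]·U(∂p))` the second (`hasDerivAt_deriv_wilsonAction4_expChart`), and
`s_p = Σ_k ‖X′_k‖` (operator norms; `= Σ_k ‖X_{b_k}‖`, `size_letters_eq`).  [B16] p.357: «the function V is at least of third order in the argument».
[cite: Balaban1985BackgroundPropagators, (3.6)–(3.7) p.391; Balaban1989LargeFieldII, (1.2) p.357, (1.17) p.360] -/
theorem abs_wilsonAction4_expChart_sub_taylor_two_le (U : GaugeField P j (SU N)) (X : PBond P j → lieSU (Fin N)) (t : ℝ) :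
    |wilsonAction4 (expChart U (t • X)) - wilsonAction4 U
        - t * (-(∑ p : Plaq P j, (Matrix.trace
          (((U ⟨p.src, p.μ⟩ : Matrix (Fin N) (Fin N) ℂ) * (X ⟨p.src, p.μ⟩ : Matrix (Fin N) (Fin N) ℂ) * star (U ⟨p.src, p.μ⟩ : Matrix (Fin N) (Fin N) ℂ)
            + (U ⟨p.src, p.μ⟩ : Matrix (Fin N) (Fin N) ℂ) * (U ⟨p.src.shift p.μ, p.ν⟩ : Matrix (Fin N) (Fin N) ℂ) * (X ⟨p.src.shift p.μ, p.ν⟩ : Matrix (Fin N) (Fin N) ℂ)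
              * star ((U ⟨p.src, p.μ⟩ : Matrix (Fin N) (Fin N) ℂ) * (U ⟨p.src.shift p.μ, p.ν⟩ : Matrix (Fin N) (Fin N) ℂ))
            + -((U ⟨p.src, p.μ⟩ : Matrix (Fin N) (Fin N) ℂ) * (U ⟨p.src.shift p.μ, p.ν⟩ : Matrix (Fin N) (Fin N) ℂ) * (X ⟨p.src.shift p.ν, p.μ⟩ : Matrix (Fin N) (Fin N) ℂ)
              * star ((U ⟨p.src, p.μ⟩ : Matrix (Fin N) (Fin N) ℂ) * (U ⟨p.src.shift p.μ, p.ν⟩ : Matrix (Fin N) (Fin N) ℂ)))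
            + -((U ⟨p.src, p.μ⟩ : Matrix (Fin N) (Fin N) ℂ) * (U ⟨p.src.shift p.μ, p.ν⟩ : Matrix (Fin N) (Fin N) ℂ) * star (U ⟨p.src.shift p.ν, p.μ⟩ : Matrix (Fin N) (Fin N) ℂ)
              * (X ⟨p.src, p.ν⟩ : Matrix (Fin N) (Fin N) ℂ)
              * star ((U ⟨p.src, p.μ⟩ : Matrix (Fin N) (Fin N) ℂ) * (U ⟨p.src.shift p.μ, p.ν⟩ : Matrix (Fin N) (Fin N) ℂ) * star (U ⟨p.src.shift p.ν, p.μ⟩ : Matrix (Fin N) (Fin N) ℂ))))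
          * ((GaugeField.plaqHol U p : SU N) : Matrix (Fin N) (Fin N) ℂ))).re) / (Fintype.card (Fin N) : ℝ))
        - t ^ 2 / 2 * (-(∑ p : Plaq P j, (Matrix.trace
          ((((U ⟨p.src, p.μ⟩ : Matrix (Fin N) (Fin N) ℂ) * (X ⟨p.src, p.μ⟩ : Matrix (Fin N) (Fin N) ℂ) * star (U ⟨p.src, p.μ⟩ : Matrix (Fin N) (Fin N) ℂ)
            + (U ⟨p.src, p.μ⟩ : Matrix (Fin N) (Fin N) ℂ) * (U ⟨p.src.shift p.μ, p.ν⟩ : Matrix (Fin N) (Fin N) ℂ) * (X ⟨p.src.shift p.μ, p.ν⟩ : Matrix (Fin N) (Fin N) ℂ)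
              * star ((U ⟨p.src, p.μ⟩ : Matrix (Fin N) (Fin N) ℂ) * (U ⟨p.src.shift p.μ, p.ν⟩ : Matrix (Fin N) (Fin N) ℂ))
            + -((U ⟨p.src, p.μ⟩ : Matrix (Fin N) (Fin N) ℂ) * (U ⟨p.src.shift p.μ, p.ν⟩ : Matrix (Fin N) (Fin N) ℂ) * (X ⟨p.src.shift p.ν, p.μ⟩ : Matrix (Fin N) (Fin N) ℂ)
              * star ((U ⟨p.src, p.μ⟩ : Matrix (Fin N) (Fin N) ℂ) * (U ⟨p.src.shift p.μ, p.ν⟩ : Matrix (Fin N) (Fin N) ℂ)))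
            + -((U ⟨p.src, p.μ⟩ : Matrix (Fin N) (Fin N) ℂ) * (U ⟨p.src.shift p.μ, p.ν⟩ : Matrix (Fin N) (Fin N) ℂ) * star (U ⟨p.src.shift p.ν, p.μ⟩ : Matrix (Fin N) (Fin N) ℂ)
              * (X ⟨p.src, p.ν⟩ : Matrix (Fin N) (Fin N) ℂ)
              * star ((U ⟨p.src, p.μ⟩ : Matrix (Fin N) (Fin N) ℂ) * (U ⟨p.src.shift p.μ, p.ν⟩ : Matrix (Fin N) (Fin N) ℂ) * star (U ⟨p.src.shift p.ν, p.μ⟩ : Matrix (Fin N) (Fin N) ℂ))))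
           * ((U ⟨p.src, p.μ⟩ : Matrix (Fin N) (Fin N) ℂ) * (X ⟨p.src, p.μ⟩ : Matrix (Fin N) (Fin N) ℂ) * star (U ⟨p.src, p.μ⟩ : Matrix (Fin N) (Fin N) ℂ)
            + (U ⟨p.src, p.μ⟩ : Matrix (Fin N) (Fin N) ℂ) * (U ⟨p.src.shift p.μ, p.ν⟩ : Matrix (Fin N) (Fin N) ℂ) * (X ⟨p.src.shift p.μ, p.ν⟩ : Matrix (Fin N) (Fin N) ℂ)
              * star ((U ⟨p.src, p.μ⟩ : Matrix (Fin N) (Fin N) ℂ) * (U ⟨p.src.shift p.μ, p.ν⟩ : Matrix (Fin N) (Fin N) ℂ))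
            + -((U ⟨p.src, p.μ⟩ : Matrix (Fin N) (Fin N) ℂ) * (U ⟨p.src.shift p.μ, p.ν⟩ : Matrix (Fin N) (Fin N) ℂ) * (X ⟨p.src.shift p.ν, p.μ⟩ : Matrix (Fin N) (Fin N) ℂ)
              * star ((U ⟨p.src, p.μ⟩ : Matrix (Fin N) (Fin N) ℂ) * (U ⟨p.src.shift p.μ, p.ν⟩ : Matrix (Fin N) (Fin N) ℂ)))
            + -((U ⟨p.src, p.μ⟩ : Matrix (Fin N) (Fin N) ℂ) * (U ⟨p.src.shift p.μ, p.ν⟩ : Matrix (Fin N) (Fin N) ℂ) * star (U ⟨p.src.shift p.ν, p.μ⟩ : Matrix (Fin N) (Fin N) ℂ)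
              * (X ⟨p.src, p.ν⟩ : Matrix (Fin N) (Fin N) ℂ)
              * star ((U ⟨p.src, p.μ⟩ : Matrix (Fin N) (Fin N) ℂ) * (U ⟨p.src.shift p.μ, p.ν⟩ : Matrix (Fin N) (Fin N) ℂ) * star (U ⟨p.src.shift p.ν, p.μ⟩ : Matrix (Fin N) (Fin N) ℂ))))
          + commSum [ (U ⟨p.src, p.μ⟩ : Matrix (Fin N) (Fin N) ℂ) * (X ⟨p.src, p.μ⟩ : Matrix (Fin N) (Fin N) ℂ) * star (U ⟨p.src, p.μ⟩ : Matrix (Fin N) (Fin N) ℂ),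
            (U ⟨p.src, p.μ⟩ : Matrix (Fin N) (Fin N) ℂ) * (U ⟨p.src.shift p.μ, p.ν⟩ : Matrix (Fin N) (Fin N) ℂ) * (X ⟨p.src.shift p.μ, p.ν⟩ : Matrix (Fin N) (Fin N) ℂ)
              * star ((U ⟨p.src, p.μ⟩ : Matrix (Fin N) (Fin N) ℂ) * (U ⟨p.src.shift p.μ, p.ν⟩ : Matrix (Fin N) (Fin N) ℂ)),
            -((U ⟨p.src, p.μ⟩ : Matrix (Fin N) (Fin N) ℂ) * (U ⟨p.src.shift p.μ, p.ν⟩ : Matrix (Fin N) (Fin N) ℂ) * (X ⟨p.src.shift p.ν, p.μ⟩ : Matrix (Fin N) (Fin N) ℂ)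
              * star ((U ⟨p.src, p.μ⟩ : Matrix (Fin N) (Fin N) ℂ) * (U ⟨p.src.shift p.μ, p.ν⟩ : Matrix (Fin N) (Fin N) ℂ))),
            -((U ⟨p.src, p.μ⟩ : Matrix (Fin N) (Fin N) ℂ) * (U ⟨p.src.shift p.μ, p.ν⟩ : Matrix (Fin N) (Fin N) ℂ) * star (U ⟨p.src.shift p.ν, p.μ⟩ : Matrix (Fin N) (Fin N) ℂ)
              * (X ⟨p.src, p.ν⟩ : Matrix (Fin N) (Fin N) ℂ)
              * star ((U ⟨p.src, p.μ⟩ : Matrix (Fin N) (Fin N) ℂ) * (U ⟨p.src.shift p.μ, p.ν⟩ : Matrix (Fin N) (Fin N) ℂ) * star (U ⟨p.src.shift p.ν, p.μ⟩ : Matrix (Fin N) (Fin N) ℂ))) ])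
          * ((GaugeField.plaqHol U p : SU N) : Matrix (Fin N) (Fin N) ℂ))).re) / (Fintype.card (Fin N) : ℝ))|
      ≤ ∑ p : Plaq P j, ((|t| * size [ (U ⟨p.src, p.μ⟩ : Matrix (Fin N) (Fin N) ℂ) * (X ⟨p.src, p.μ⟩ : Matrix (Fin N) (Fin N) ℂ) * star (U ⟨p.src, p.μ⟩ : Matrix (Fin N) (Fin N) ℂ),
            (U ⟨p.src, p.μ⟩ : Matrix (Fin N) (Fin N) ℂ) * (U ⟨p.src.shift p.μ, p.ν⟩ : Matrix (Fin N) (Fin N) ℂ) * (X ⟨p.src.shift p.μ, p.ν⟩ : Matrix (Fin N) (Fin N) ℂ)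
              * star ((U ⟨p.src, p.μ⟩ : Matrix (Fin N) (Fin N) ℂ) * (U ⟨p.src.shift p.μ, p.ν⟩ : Matrix (Fin N) (Fin N) ℂ)),
            -((U ⟨p.src, p.μ⟩ : Matrix (Fin N) (Fin N) ℂ) * (U ⟨p.src.shift p.μ, p.ν⟩ : Matrix (Fin N) (Fin N) ℂ) * (X ⟨p.src.shift p.ν, p.μ⟩ : Matrix (Fin N) (Fin N) ℂ)
              * star ((U ⟨p.src, p.μ⟩ : Matrix (Fin N) (Fin N) ℂ) * (U ⟨p.src.shift p.μ, p.ν⟩ : Matrix (Fin N) (Fin N) ℂ))),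
            -((U ⟨p.src, p.μ⟩ : Matrix (Fin N) (Fin N) ℂ) * (U ⟨p.src.shift p.μ, p.ν⟩ : Matrix (Fin N) (Fin N) ℂ) * star (U ⟨p.src.shift p.ν, p.μ⟩ : Matrix (Fin N) (Fin N) ℂ)
              * (X ⟨p.src, p.ν⟩ : Matrix (Fin N) (Fin N) ℂ)
              * star ((U ⟨p.src, p.μ⟩ : Matrix (Fin N) (Fin N) ℂ) * (U ⟨p.src.shift p.μ, p.ν⟩ : Matrix (Fin N) (Fin N) ℂ) * star (U ⟨p.src.shift p.ν, p.μ⟩ : Matrix (Fin N) (Fin N) ℂ))) ]) ^ 3 / 6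
          * Real.exp (|t| * size [ (U ⟨p.src, p.μ⟩ : Matrix (Fin N) (Fin N) ℂ) * (X ⟨p.src, p.μ⟩ : Matrix (Fin N) (Fin N) ℂ) * star (U ⟨p.src, p.μ⟩ : Matrix (Fin N) (Fin N) ℂ),
            (U ⟨p.src, p.μ⟩ : Matrix (Fin N) (Fin N) ℂ) * (U ⟨p.src.shift p.μ, p.ν⟩ : Matrix (Fin N) (Fin N) ℂ) * (X ⟨p.src.shift p.μ, p.ν⟩ : Matrix (Fin N) (Fin N) ℂ)
              * star ((U ⟨p.src, p.μ⟩ : Matrix (Fin N) (Fin N) ℂ) * (U ⟨p.src.shift p.μ, p.ν⟩ : Matrix (Fin N) (Fin N) ℂ)),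
            -((U ⟨p.src, p.μ⟩ : Matrix (Fin N) (Fin N) ℂ) * (U ⟨p.src.shift p.μ, p.ν⟩ : Matrix (Fin N) (Fin N) ℂ) * (X ⟨p.src.shift p.ν, p.μ⟩ : Matrix (Fin N) (Fin N) ℂ)
              * star ((U ⟨p.src, p.μ⟩ : Matrix (Fin N) (Fin N) ℂ) * (U ⟨p.src.shift p.μ, p.ν⟩ : Matrix (Fin N) (Fin N) ℂ))),
            -((U ⟨p.src, p.μ⟩ : Matrix (Fin N) (Fin N) ℂ) * (U ⟨p.src.shift p.μ, p.ν⟩ : Matrix (Fin N) (Fin N) ℂ) * star (U ⟨p.src.shift p.ν, p.μ⟩ : Matrix (Fin N) (Fin N) ℂ)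
              * (X ⟨p.src, p.ν⟩ : Matrix (Fin N) (Fin N) ℂ)
              * star ((U ⟨p.src, p.μ⟩ : Matrix (Fin N) (Fin N) ℂ) * (U ⟨p.src.shift p.μ, p.ν⟩ : Matrix (Fin N) (Fin N) ℂ) * star (U ⟨p.src.shift p.ν, p.μ⟩ : Matrix (Fin N) (Fin N) ℂ))) ])) := by
  -- the action at `t` and at `0` as plaquette sums
  have h0 : wilsonAction4 U = ∑ p : Plaq P j, (1 - (Matrix.trace ((GaugeField.plaqHol U p : SU N) : Matrix (Fin N) (Fin N) ℂ)).re / (Fintype.card (Fin N) : ℝ)) := by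
    have h := wilsonAction4_expChart_smul_eq U X 0
    simp only [zero_smul, expChart_zero, holPath_zero, one_mul] at h
    exact h
  rw [wilsonAction4_expChart_smul_eq, h0]
  -- gather the four sums into one and estimate term by term
  rw [show ∀ (a b c d : Plaq P j → ℝ) (N' : ℝ),
      (∑ p, (1 - a p / N')) - (∑ p, (1 - b p / N')) - t * (-(∑ p, c p) / N') - t ^ 2 / 2 * (-(∑ p, d p) / N')
        = ∑ p, -(a p / N' - b p / N' - t * (c p / N') - t ^ 2 / 2 * (d p / N')) by
      intro a b c d N'
      simp only [Finset.sum_sub_distrib, Finset.sum_neg_distrib, neg_div, Finset.sum_div, Finset.mul_sum, mul_neg, sub_neg_eq_add]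
      ring]
  refine (Finset.abs_sum_le_sum_abs _ _).trans (Finset.sum_le_sum fun p _ => ?_)
  rw [abs_neg]
  have hW : ((GaugeField.plaqHol U p : SU N) : Matrix (Fin N) (Fin N) ℂ) ∈ unitary (Matrix (Fin N) (Fin N) ℂ) := (GaugeField.plaqHol U p).2.1
  have h := abs_re_trace_holPath_sub_taylor_two_le
    [ (U ⟨p.src, p.μ⟩ : Matrix (Fin N) (Fin N) ℂ) * (X ⟨p.src, p.μ⟩ : Matrix (Fin N) (Fin N) ℂ) * star (U ⟨p.src, p.μ⟩ : Matrix (Fin N) (Fin N) ℂ),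
      (U ⟨p.src, p.μ⟩ : Matrix (Fin N) (Fin N) ℂ) * (U ⟨p.src.shift p.μ, p.ν⟩ : Matrix (Fin N) (Fin N) ℂ) * (X ⟨p.src.shift p.μ, p.ν⟩ : Matrix (Fin N) (Fin N) ℂ)
        * star ((U ⟨p.src, p.μ⟩ : Matrix (Fin N) (Fin N) ℂ) * (U ⟨p.src.shift p.μ, p.ν⟩ : Matrix (Fin N) (Fin N) ℂ)),
      -((U ⟨p.src, p.μ⟩ : Matrix (Fin N) (Fin N) ℂ) * (U ⟨p.src.shift p.μ, p.ν⟩ : Matrix (Fin N) (Fin N) ℂ) * (X ⟨p.src.shift p.ν, p.μ⟩ : Matrix (Fin N) (Fin N) ℂ)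
        * star ((U ⟨p.src, p.μ⟩ : Matrix (Fin N) (Fin N) ℂ) * (U ⟨p.src.shift p.μ, p.ν⟩ : Matrix (Fin N) (Fin N) ℂ))),
      -((U ⟨p.src, p.μ⟩ : Matrix (Fin N) (Fin N) ℂ) * (U ⟨p.src.shift p.μ, p.ν⟩ : Matrix (Fin N) (Fin N) ℂ) * star (U ⟨p.src.shift p.ν, p.μ⟩ : Matrix (Fin N) (Fin N) ℂ)
        * (X ⟨p.src, p.ν⟩ : Matrix (Fin N) (Fin N) ℂ)
        * star ((U ⟨p.src, p.μ⟩ : Matrix (Fin N) (Fin N) ℂ) * (U ⟨p.src.shift p.μ, p.ν⟩ : Matrix (Fin N) (Fin N) ℂ) * star (U ⟨p.src.shift p.ν, p.μ⟩ : Matrix (Fin N) (Fin N) ℂ))) ]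
    hW t
  simp only [List.sum_cons, List.sum_nil, add_zero, add_assoc] at h ⊢
  exact h

end Taylor

/-! ## §4  The flat plaquette variable `U(∂p) = 1`: the commutator term drops and the second variation is the `∂*∂`-type form `(1∕N)Σ_p Re Tr(σ_p⋆σ_p)` -/

section Flat
variable {N : ℕ}

/-- A unitary conjugate of a skew-Hermitian letter is skew-Hermitian: `(VYV⋆)⋆ = −VYV⋆`. [cite: Balaban1985BackgroundPropagators, (3.2) p.390 (the letters `A′(b)`)] -/
theorem star_conj_of_star_eq_neg {V Y : Matrix (Fin N) (Fin N) ℂ} (hY : star Y = -Y) : star (V * Y * star V) = -(V * Y * star V) := by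
  rw [star_mul, star_mul, star_star, hY, neg_mul, mul_neg, mul_assoc]

/-- A sum of skew-Hermitian letters is skew-Hermitian. [cite: Balaban1985BackgroundPropagators, (3.4) p.391 (bookkeeping)] -/
theorem star_sum_of_skew (l : List (Matrix (Fin N) (Fin N) ℂ)) (h : ∀ a ∈ l, star a = -a) : star l.sum = -l.sum := by
  induction l with
  | nil => simp
  | cons b l ih =>
    rw [List.sum_cons, star_add, h b (by simp), ih fun a ha => h a (by simp [ha]), neg_add]

/-- The ordered commutator sum of skew-Hermitian letters is skew-Hermitian: `(Σ_{k<l}[a_k,a_l])⋆ = −Σ_{k<l}[a_k,a_l]`.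
[cite: Balaban1985BackgroundPropagators, (3.6) p.391 (bookkeeping)] -/
theorem star_commSum_of_skew (l : List (Matrix (Fin N) (Fin N) ℂ)) (h : ∀ a ∈ l, star a = -a) : star (commSum l) = -commSum l := by
  induction l with
  | nil => simp
  | cons b l ih =>
    have hb : star b = -b := h b (by simp)
    have hl : ∀ a ∈ l, star a = -a := fun a ha => h a (by simp [ha])
    rw [Beta.TransportVertices.commSum_cons, star_add, ih hl, star_sub, star_mul, star_mul, hb, star_sum_of_skew l hl]
    noncomm_ring

/-- The trace of a skew-Hermitian matrix is purely imaginary: `Re Tr M = 0`. [cite: Balaban1985Variational, (4) p.278 (bookkeeping)] -/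
theorem re_trace_eq_zero_of_star_eq_neg {M : Matrix (Fin N) (Fin N) ℂ} (h : star M = -M) : (Matrix.trace M).re = 0 := by
  have h1 : Matrix.trace (star M) = star (Matrix.trace M) := Matrix.trace_conjTranspose M
  rw [h, Matrix.trace_neg] at h1
  have h2 := congrArg Complex.re h1
  rw [Complex.neg_re, Complex.star_def, Complex.conj_re] at h2
  linarith

/-- For skew-Hermitian `S`: `Re Tr(S²) = −Re Tr(S⋆S)` (`= −‖S‖²_HS ≤ 0`). [cite: Balaban1985Averaging, (17)–(18) p.21 (bookkeeping)] -/
theorem re_trace_mul_self_of_star_eq_neg {S : Matrix (Fin N) (Fin N) ℂ} (h : star S = -S) :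
    (Matrix.trace (S * S)).re = -(Matrix.trace (star S * S)).re := by
  rw [h, neg_mul, Matrix.trace_neg, Complex.neg_re, neg_neg]

/-- The four transported letters of §2 are skew-Hermitian. [cite: Balaban1985BackgroundPropagators, (3.2) p.390, (3.5) p.391] -/
theorem star_letters_eq_neg (A B C : SU N) (X₁ X₂ X₃ X₄ : lieSU (Fin N)) :
    ∀ a ∈ [ (A : Matrix (Fin N) (Fin N) ℂ) * (X₁ : Matrix (Fin N) (Fin N) ℂ) * star (A : Matrix (Fin N) (Fin N) ℂ),
        (A : Matrix (Fin N) (Fin N) ℂ) * (B : Matrix (Fin N) (Fin N) ℂ) * (X₂ : Matrix (Fin N) (Fin N) ℂ) * star ((A : Matrix (Fin N) (Fin N) ℂ) * (B : Matrix (Fin N) (Fin N) ℂ)),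
        -((A : Matrix (Fin N) (Fin N) ℂ) * (B : Matrix (Fin N) (Fin N) ℂ) * (X₃ : Matrix (Fin N) (Fin N) ℂ) * star ((A : Matrix (Fin N) (Fin N) ℂ) * (B : Matrix (Fin N) (Fin N) ℂ))),
        -((A : Matrix (Fin N) (Fin N) ℂ) * (B : Matrix (Fin N) (Fin N) ℂ) * star (C : Matrix (Fin N) (Fin N) ℂ) * (X₄ : Matrix (Fin N) (Fin N) ℂ)
            * star ((A : Matrix (Fin N) (Fin N) ℂ) * (B : Matrix (Fin N) (Fin N) ℂ) * star (C : Matrix (Fin N) (Fin N) ℂ))) ], star a = -a := by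
  refine List.forall_mem_cons.2 ⟨star_conj_of_star_eq_neg (star_coe_lieSU X₁), List.forall_mem_cons.2 ⟨star_conj_of_star_eq_neg (star_coe_lieSU X₂),
    List.forall_mem_cons.2 ⟨?_, List.forall_mem_cons.2 ⟨?_, List.forall_mem_nil _⟩⟩⟩⟩
  · rw [star_neg, neg_inj]
    exact star_conj_of_star_eq_neg (star_coe_lieSU X₃)
  · rw [star_neg, neg_inj]
    exact star_conj_of_star_eq_neg (star_coe_lieSU X₄)

variable {P : Params} {j : ℕ} [NeZero N]

/-- ★ **THE SECOND VARIATION AT A BACKGROUND WITH FLAT PLAQUETTE VARIABLES** (`U(∂p) = 1` for every `p`, e.g. `U ≡ 1` or a pure gauge): the commutator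
(«spin») term is traceless and `d²∕dt² A(U·e^{tX})∣₀ = (1∕N)·Σ_p Re Tr(σ_p⋆σ_p) ≥ 0`, `σ_p = X′₁+X′₂+X′₃+X′₄` — «the quadratic form with the background field identically
equal to 1» that [B16] p.357 compares with `⟨B′, Δ_kB′⟩` of [10] (1.65)–(1.66), «generalizing the operator ∂*∂ in the Abelian case» ([B9] p.392; at `U ≡ 1` the letters are `±X_b`
and `σ_p` is the plain lattice curl of `X` around `∂p`). [cite: Balaban1985BackgroundPropagators, (3.7) p.391, (3.10) p.392; Balaban1989LargeFieldII, (1.7) p.358, p.357] -/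
theorem secondVariation_expChart_of_plaqHol_eq_one (U : GaugeField P j (SU N)) (X : PBond P j → lieSU (Fin N))
    (hU : ∀ p : Plaq P j, GaugeField.plaqHol U p = 1) :
    HasDerivAt (deriv fun s : ℝ => wilsonAction4 (expChart U (s • X)))
      ((∑ p : Plaq P j, (Matrix.trace
        (star ((U ⟨p.src, p.μ⟩ : Matrix (Fin N) (Fin N) ℂ) * (X ⟨p.src, p.μ⟩ : Matrix (Fin N) (Fin N) ℂ) * star (U ⟨p.src, p.μ⟩ : Matrix (Fin N) (Fin N) ℂ)
            + (U ⟨p.src, p.μ⟩ : Matrix (Fin N) (Fin N) ℂ) * (U ⟨p.src.shift p.μ, p.ν⟩ : Matrix (Fin N) (Fin N) ℂ) * (X ⟨p.src.shift p.μ, p.ν⟩ : Matrix (Fin N) (Fin N) ℂ)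
              * star ((U ⟨p.src, p.μ⟩ : Matrix (Fin N) (Fin N) ℂ) * (U ⟨p.src.shift p.μ, p.ν⟩ : Matrix (Fin N) (Fin N) ℂ))
            + -((U ⟨p.src, p.μ⟩ : Matrix (Fin N) (Fin N) ℂ) * (U ⟨p.src.shift p.μ, p.ν⟩ : Matrix (Fin N) (Fin N) ℂ) * (X ⟨p.src.shift p.ν, p.μ⟩ : Matrix (Fin N) (Fin N) ℂ)
              * star ((U ⟨p.src, p.μ⟩ : Matrix (Fin N) (Fin N) ℂ) * (U ⟨p.src.shift p.μ, p.ν⟩ : Matrix (Fin N) (Fin N) ℂ)))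
            + -((U ⟨p.src, p.μ⟩ : Matrix (Fin N) (Fin N) ℂ) * (U ⟨p.src.shift p.μ, p.ν⟩ : Matrix (Fin N) (Fin N) ℂ) * star (U ⟨p.src.shift p.ν, p.μ⟩ : Matrix (Fin N) (Fin N) ℂ)
              * (X ⟨p.src, p.ν⟩ : Matrix (Fin N) (Fin N) ℂ)
              * star ((U ⟨p.src, p.μ⟩ : Matrix (Fin N) (Fin N) ℂ) * (U ⟨p.src.shift p.μ, p.ν⟩ : Matrix (Fin N) (Fin N) ℂ) * star (U ⟨p.src.shift p.ν, p.μ⟩ : Matrix (Fin N) (Fin N) ℂ))))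
          * ((U ⟨p.src, p.μ⟩ : Matrix (Fin N) (Fin N) ℂ) * (X ⟨p.src, p.μ⟩ : Matrix (Fin N) (Fin N) ℂ) * star (U ⟨p.src, p.μ⟩ : Matrix (Fin N) (Fin N) ℂ)
            + (U ⟨p.src, p.μ⟩ : Matrix (Fin N) (Fin N) ℂ) * (U ⟨p.src.shift p.μ, p.ν⟩ : Matrix (Fin N) (Fin N) ℂ) * (X ⟨p.src.shift p.μ, p.ν⟩ : Matrix (Fin N) (Fin N) ℂ)
              * star ((U ⟨p.src, p.μ⟩ : Matrix (Fin N) (Fin N) ℂ) * (U ⟨p.src.shift p.μ, p.ν⟩ : Matrix (Fin N) (Fin N) ℂ))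
            + -((U ⟨p.src, p.μ⟩ : Matrix (Fin N) (Fin N) ℂ) * (U ⟨p.src.shift p.μ, p.ν⟩ : Matrix (Fin N) (Fin N) ℂ) * (X ⟨p.src.shift p.ν, p.μ⟩ : Matrix (Fin N) (Fin N) ℂ)
              * star ((U ⟨p.src, p.μ⟩ : Matrix (Fin N) (Fin N) ℂ) * (U ⟨p.src.shift p.μ, p.ν⟩ : Matrix (Fin N) (Fin N) ℂ)))
            + -((U ⟨p.src, p.μ⟩ : Matrix (Fin N) (Fin N) ℂ) * (U ⟨p.src.shift p.μ, p.ν⟩ : Matrix (Fin N) (Fin N) ℂ) * star (U ⟨p.src.shift p.ν, p.μ⟩ : Matrix (Fin N) (Fin N) ℂ)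
              * (X ⟨p.src, p.ν⟩ : Matrix (Fin N) (Fin N) ℂ)
              * star ((U ⟨p.src, p.μ⟩ : Matrix (Fin N) (Fin N) ℂ) * (U ⟨p.src.shift p.μ, p.ν⟩ : Matrix (Fin N) (Fin N) ℂ) * star (U ⟨p.src.shift p.ν, p.μ⟩ : Matrix (Fin N) (Fin N) ℂ)))))).re)
        / (Fintype.card (Fin N) : ℝ)) 0 := by
  refine (hasDerivAt_deriv_wilsonAction4_expChart U X).congr_deriv ?_
  rw [neg_div, neg_eq_iff_eq_neg, ← neg_div, ← Finset.sum_neg_distrib]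
  congr 1
  refine Finset.sum_congr rfl fun p _ => ?_
  have hW : ((GaugeField.plaqHol U p : SU N) : Matrix (Fin N) (Fin N) ℂ) = 1 := by rw [hU p]; rfl
  have hsk := star_letters_eq_neg (U ⟨p.src, p.μ⟩) (U ⟨p.src.shift p.μ, p.ν⟩) (U ⟨p.src.shift p.ν, p.μ⟩)
    (X ⟨p.src, p.μ⟩) (X ⟨p.src.shift p.μ, p.ν⟩) (X ⟨p.src.shift p.ν, p.μ⟩) (X ⟨p.src, p.ν⟩)
  have hσ := star_sum_of_skew _ hsk
  simp only [List.sum_cons, List.sum_nil, add_zero] at hσ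
  rw [hW, mul_one, Matrix.trace_add, Complex.add_re, re_trace_eq_zero_of_star_eq_neg (star_commSum_of_skew _ hsk), add_zero]
  simp only [add_assoc]
  rw [re_trace_mul_self_of_star_eq_neg hσ]

end Flat

end Literature.MathematicalPhysics.QuantumFieldTheory.Balaban1983to89.Node00

end
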